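import Summits.BirchSwinnertonDyer.BirchSwinnertonDyer.Theorems.ManinLocalTwoThreeManinPrimeToAdditiveFiveLeRedSevenTypeIITwinAnchor
import Summits.BirchSwinnertonDyer.BirchSwinnertonDyer.Theorems.ManinLocalTwoThreeManinPrimeToAdditiveFiveLeDegreeUpThirteenOfOrdinaryTwistLaw
import Summits.BirchSwinnertonDyer.BirchSwinnertonDyer.Theorems.ManinLocalTwoThreeManinPrimeToAdditiveFiveLeRedFiveSevenCells
import Summits.BirchSwinnertonDyer.Rank1Residual.Additive.SubGordHigherOrdinary
import Summits.BirchSwinnertonDyer.Rank1Residual.Additive.PotentiallyOrdinaryTypeG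
import HarnessLib

/-!
# Route `ManinLocalTwoThree`, residual crux C5 `ManinPrimeToAdditiveFiveLe`
# (stmt-BirchSwinnertonDyer-22969), line `upper_anchor` (skeleton v9, registered stubs `stub_red7ordIV`,
# `stub_red57corner`): **every potentially ORDINARY unstarred optimal curve has a COMMUTING STARRED optimal
# twin with the same `v_p(c)`, granted E-imc-9 `OrdinaryRamifiedTwistLaw p` — potential ordinarity DISCHARGED**

Width seat bsd-line-ml23-c5-p1-w3 (gen 0), piece φ (part 1/2: the engine). Skeleton v9 of the line
(`Cruxes/ManinPrimeToAdditiveFiveLe/Lines/upper_anchor.lean`, lead gen 5) cuts the `W[p]`-reducible unstarred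
residue of C5 at `p ∈ {5, 7}` into three Raynaud cells; two of them are potentially ORDINARY (tame index
`e ∣ p − 1`): `stub_red7ordIV` = `(7; IV)` (`e = 3`) and `stub_red57corner` = `(5; III) ∪ (7; II)`
(`e = p − 1`). In Cremona's range every such orbit COMMUTES with its starred `χ_{p*}`-twin and the optimal
degree goes UP by `p` (LEDGER-upper-anchor.md gen 4: 377 + 112 + 43 orbits). The imc cell's registered,
refuter-vetted `@[conjecture]` E-imc-9 `Summit.BirchSwinnertonDyer.Rank1Residual.ManinAdditive.OrdinaryRamifiedTwistLaw p`
says exactly this at every potentially good ORDINARY additive `p ≥ 5` from the unstarred end.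

THIS FILE proves, kernel-checked, for EVERY prime `p ≥ 5` and with NO reducibility hypothesis:

* §1 `exists_commuting_starred_twin_of_ordinaryRamifiedTwistLaw` — **the twin packet.** Granted
  `OrdinaryRamifiedTwistLaw p` and modularity: a globally minimal `W` with a lattice-optimal conductor-level
  datum `D`, `p² ∣ N(W)`, no odd semistable untwist (the crux's twist-minimality cut), `ord_p Δ_min(W) ≤ 4`
  and `e = 12 / gcd(12, ord_p Δ_min) ∣ p − 1` has a lattice-optimal globally minimal `W₀ = u • (W ⊗ p*)` with
  `N(W₀) = N(W)`, `p² ∣ N(W₀)`, `deg(D₀) = p · deg(D)`, `v_p c(D₀) = v_p c(D)` and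
  `ord_p Δ_min(W₀) = ord_p Δ_min(W) + 6` (Kodaira IV*/III*/II*). The potential ORDINARITY that E-imc-9 wants
  (`HasPotentiallyGoodOrdinaryReductionAtPrime`) is NOT assumed: it is DERIVED from `e ∣ p − 1`, `e ≠ 2`
  and `0 ≤ ord_p j` (a globally minimal model of `W ⊗ p*` is additive at `p` as well, having the conductor of
  the twin; `padicValRat_j_nonneg_of_pStar_pair_addv`) by the Rank1Residual cell's dictionary
  `typeGOrd_of_addv_of_subGordHigher` (cyclotomic good reduction + `j ≡ 0 / 1728` ordinarity criteria) and
  `typeGOrd_iff_exists_good_unitRoot`. Then the an-cell's PROVED optimal-orbit trichotomy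
  (`pStar_optimal_orbit_trichotomy_full`) on `(D, D₀)`, `D₀` the lattice-optimal datum of the class of
  `W ⊗ p*`: case (ii) (degree down) contradicts clause 2 of E-imc-9; case (iii) (flip) contradicts clause 1
  + the index engine at `s = 1` exactly as in the width seat -w2's υ2 (p626766); case (i) with the PROVED
  near-invariance (`pStar_optimal_commuting_manin_near_invariance`) gives the packet.
* §2 `not_dvd_maninConstant_of_unstarred_ordinary_of_edixhovenKodairaFact_of_ordinaryRamifiedTwistLaw` —
  **Edixhoven's open CASE 1 at `p > 7` ⟸ EdK ∧ E-imc-9(p)**: for `p > 7`, the twin is starred, Edixhoven's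
  printed Kodaira statement (`edixhoven_not_dvd_maninConstant_of_kodairaSymbol_ne`, cite-only) gives
  `p ∤ c(D₀)`, hence `p ∤ c(D)`. This is a Kato-free (F″-independent) route to the potentially ordinary
  unstarred locus at `p ≥ 11` of C5's informal residual, irreducible or not (compare the line's Kato route
  p608285/p611587, which needs `W[p]` irreducible and the referee-flagged reading F″).
* §3 `redCuts_of_commuting_starred_twin` — transfer of the RED(57♯) cuts (twist-minimality, reducibility,
  `N > 5·10⁵`, `p ∣ deg`, no `Iₙ*`) from `W` to the twin `W₀` (bookkeeping for part 2/2, the cell theorems).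

HONEST STATUS. Conditional results (`--supports`, helper): E-imc-9 is an OPEN conjecture of the cell (REF1
SURVIVES 2026-08-27, 85 108 / 85 108 exact ratio `p` in range; not in print), EdK is a cite-only printed fact.
Nothing here proves any stub, C5, E-imc-9, Manin's conjecture or BSD. No summit statement is proved by this seat.

References: [EdixhovenManin1991] Thm. 3, Prop. 7, §4 (case 1 / case 2); [ZagierCMB1985] §1;
[Stevens1989] (5.2), (5.4); [DiamondShurman2005] §5.8, Thm. 8.8.3; [SerreTate1968] §2 Cor. 3;
[SilvermanATAEC1994] IV Table 4.1; cell bsd-f2-manin MEMO-imc.md §10 (E-imc-9).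
-/

set_option autoImplicit false
-- the Theorems namespace of this sub repeats the summit name by design (D-0017 nested layout)
set_option linter.dupNamespace false

noncomputable section

open scoped Classical NumberField

namespace Summit.BirchSwinnertonDyer.BirchSwinnertonDyer.Theorems

open WeierstrassCurve IsDedekindDomain IsDedekindDomain.HeightOneSpectrum Rat.HeightOneSpectrum NumberField
  Literature.NumberTheory.EllipticCurves Literature.NumberTheory.EllipticCurves.ModularForms
  Literature.NumberTheory.EllipticCurves.Rank1Residual
  Literature.NumberTheory.DiophantineGeometry
  Summit.BirchSwinnertonDyer.Rank1Residual.ManinAdditive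
  Summit.BirchSwinnertonDyer.Rank1Residual.Additive

/-! ## §0 Potential ordinarity of an unstarred additive fibre with `e ∣ p − 1`, discharged -/

/-- **`ord_p Δ_min ≤ 4`, `0 ≤ ord_p j` and `e ∣ p − 1` at an additive `p ≥ 5` ⟹ potentially good ORDINARY
at `p`** (the hypothesis `HasPotentiallyGoodOrdinaryReductionAtPrime` of E-imc-9), kernel-derived: the fibre is
II/III/IV (Ogg–Tate), so no `Iₙ*`, `f_p = 2`, `e ∈ {6, 4, 3}` (`≠ 2`); the cell dictionary
`typeGOrd_of_addv_of_subGordHigher` gives Delbourgo's (G)-ordinary, and `typeGOrd_iff_exists_good_unitRoot`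
reads it as good ordinary reduction over some number field above `p`.
[cite: SerreTate1968, §2 Cor. 3] [cite: SilvermanATAEC1994, IV Table 4.1] -/
theorem hasPotentiallyGoodOrdinaryReductionAtPrime_of_unstarred_of_semistabilityIndex_dvd
    (W : WeierstrassCurve ℚ) [W.IsElliptic] [W.IsGloballyMinimal] (p : ℕ) [Fact p.Prime] (h5 : 5 ≤ p)
    (hadd : Addv W p) (hj : 0 ≤ padicValRat p W.j) (hv4 : padicValInt p W.minimalDiscriminantInt ≤ 4)
    (he : semistabilityIndex W p ∣ p - 1) :
    W.HasPotentiallyGoodOrdinaryReductionAtPrime p ∧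
      (padicValInt p W.minimalDiscriminantInt = 2 ∨ padicValInt p W.minimalDiscriminantInt = 3 ∨
        padicValInt p W.minimalDiscriminantInt = 4) ∧
      ∀ n : ℕ, W.kodairaSymbolAt (placeOf p) ≠ .Istar n := by
  have hcell : (padicValInt p W.minimalDiscriminantInt = 2 ∨ padicValInt p W.minimalDiscriminantInt = 3 ∨
      padicValInt p W.minimalDiscriminantInt = 4) ∧ ∀ n : ℕ, W.kodairaSymbolAt (placeOf p) ≠ .Istar n := by
    rcases kodairaSymbolAt_placeOf_cases_of_addv W p h5 hadd with
      ⟨hk, hv⟩ | ⟨hk, hv⟩ | ⟨hk, hv⟩ | ⟨n, -, hv⟩ | ⟨-, hv⟩ | ⟨-, hv⟩ | ⟨-, hv⟩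
    · exact ⟨Or.inl hv, fun n h ↦ by rw [hk] at h; cases h⟩
    · exact ⟨Or.inr (Or.inl hv), fun n h ↦ by rw [hk] at h; cases h⟩
    · exact ⟨Or.inr (Or.inr hv), fun n h ↦ by rw [hk] at h; cases h⟩
    all_goals omega
  obtain ⟨hv234, hI⟩ := hcell
  have hne2 : semistabilityIndex W p ≠ 2 := by
    unfold semistabilityIndex
    rcases hv234 with hv | hv | hv <;> rw [hv] <;> decide
  have hS : SubGordHigher W p :=
    ⟨⟨not_lt.mpr hj, condExpTwo_of_addv_of_five_le W p h5 hadd, he⟩, hne2⟩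
  have hG : TypeGOrd W p := typeGOrd_of_addv_of_subGordHigher W p h5 hadd hS
  exact ⟨(typeGOrd_iff_exists_good_unitRoot W p h5 hadd).mp hG, hv234, hI⟩

/-! ## §1 The commuting starred twin packet, from E-imc-9 -/

/-- **THE TWIN PACKET.** Granted modularity (`hnf`) and E-imc-9 `OrdinaryRamifiedTwistLaw p` (`hO`, OPEN
conjecture of the cell, taken as a hypothesis): a globally minimal `W` with lattice-optimal conductor-level
datum `D`, `p ≥ 5`, `p² ∣ N(W)`, no odd semistable untwist, `ord_p Δ_min(W) ≤ 4` (Kodaira II/III/IV) and tame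
index `e ∣ p − 1` has a COMMUTING lattice-optimal globally minimal twin `W₀ = u • (W ⊗ p*)`, `W ⊗ p* ∼ W₀`,
`W ∼ W₀ ⊗ p*`, `N(W₀) = N(W)`, `p² ∣ N(W₀)`, with `deg(D₀) = p·deg(D)`, `v_p c(D₀) = v_p c(D)` and
`ord_p Δ_min(W₀) = ord_p Δ_min(W) + 6`. Proof in the module docstring (§0 + trichotomy + E-imc-9 clauses 1, 2 +
index engine at `s = 1` + near-invariance). Conditional result; closes nothing.
[cite: ZagierCMB1985, §1] [cite: DiamondShurman2005, §5.8 and Thm. 8.8.3] [cite: EdixhovenManin1991, §4] -/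
theorem exists_commuting_starred_twin_of_ordinaryRamifiedTwistLaw (hnf : exists_isNewformOf) {p : ℕ}
    (hp : p.Prime) (h5 : 5 ≤ p) (hO : OrdinaryRamifiedTwistLaw p)
    (W : WeierstrassCurve ℚ) [W.IsElliptic] [W.IsGloballyMinimal] [NeZero (W.conductorNorm ℤ)]
    (D : ModularParametrizationData W (W.conductorNorm ℤ)) (hD : IsLatticeOptimal D)
    (hpN : p ^ 2 ∣ W.conductorNorm ℤ)
    (hodd : ¬ (∃ (W' : WeierstrassCurve ℚ) (q : ℕ), W'.IsElliptic ∧ W'.IsGloballyMinimal ∧ q.Prime ∧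
        q ≠ 2 ∧ q ^ 2 ∣ W.conductorNorm ℤ ∧
        IsIsogenous W (W'.quadraticTwist (((-1 : ℤ) ^ (q / 2) * q : ℤ) : ℚ)) ∧
        ¬ q ^ 2 ∣ W'.conductorNorm ℤ))
    (hv4 : padicValInt p W.minimalDiscriminantInt ≤ 4)
    (he : 12 / Nat.gcd 12 (padicValInt p W.minimalDiscriminantInt) ∣ p - 1) :
    ∃ (W₀ : WeierstrassCurve ℚ) (_ : W₀.IsElliptic) (_ : W₀.IsGloballyMinimal)
      (_ : NeZero (W₀.conductorNorm ℤ)) (u : VariableChange ℚ)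
      (D₀ : ModularParametrizationData W₀ (W₀.conductorNorm ℤ)),
      IsLatticeOptimal D₀ ∧ u • W.quadraticTwist ((((-1 : ℤ) ^ (p / 2) * p : ℤ)) : ℚ) = W₀ ∧
      IsIsogenous (W.quadraticTwist ((((-1 : ℤ) ^ (p / 2) * p : ℤ)) : ℚ)) W₀ ∧
      IsIsogenous W (W₀.quadraticTwist ((((-1 : ℤ) ^ (p / 2) * p : ℤ)) : ℚ)) ∧
      W₀.conductorNorm ℤ = W.conductorNorm ℤ ∧ p ^ 2 ∣ W₀.conductorNorm ℤ ∧
      D₀.modularDegree = p * D.modularDegree ∧ padicValInt p D₀.c = padicValInt p D.c ∧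
      padicValInt p W₀.minimalDiscriminantInt = padicValInt p W.minimalDiscriminantInt + 6 := by
  haveI hpF : Fact p.Prime := ⟨hp⟩
  have hp2 : p ≠ 2 := by omega
  have hd0 : ((((-1 : ℤ) ^ (p / 2) * p : ℤ)) : ℚ) ≠ 0 := by
    push_cast
    exact mul_ne_zero (pow_ne_zero _ (by norm_num)) (by exact_mod_cast hp.ne_zero)
  haveI : (W.quadraticTwist ((((-1 : ℤ) ^ (p / 2) * p : ℤ)) : ℚ)).IsElliptic := W.isElliptic_quadraticTwist hd0
  -- the lattice-optimal globally minimal curve `W₀` of the class of `W ⊗ p*`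
  obtain ⟨W₀, hE₀, hM₀, hne₀, D₀, hD₀, hiso⟩ :=
    exists_isIsogenous_latticeOptimal hnf (W.quadraticTwist ((((-1 : ℤ) ^ (p / 2) * p : ℤ)) : ℚ))
  haveI := hE₀
  haveI := hM₀
  haveI := hne₀
  haveI : (W₀.quadraticTwist ((((-1 : ℤ) ^ (p / 2) * p : ℤ)) : ℚ)).IsElliptic := W₀.isElliptic_quadraticTwist hd0
  haveI : ((W.quadraticTwist ((((-1 : ℤ) ^ (p / 2) * p : ℤ)) : ℚ)).quadraticTwist
      ((((-1 : ℤ) ^ (p / 2) * p : ℤ)) : ℚ)).IsElliptic :=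
    (W.quadraticTwist ((((-1 : ℤ) ^ (p / 2) * p : ℤ)) : ℚ)).isElliptic_quadraticTwist hd0
  -- `W ∼ W₀ ⊗ p*`
  have htw : IsIsogenous W (W₀.quadraticTwist ((((-1 : ℤ) ^ (p / 2) * p : ℤ)) : ℚ)) := by
    obtain ⟨Cq, hCq⟩ := W.exists_variableChange_smul_eq_quadraticTwist_sq hd0
    have h1 : IsIsogenous W ((W.quadraticTwist ((((-1 : ℤ) ^ (p / 2) * p : ℤ)) : ℚ)).quadraticTwist
        ((((-1 : ℤ) ^ (p / 2) * p : ℤ)) : ℚ)) := by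
      rw [quadraticTwist_quadraticTwist, ← sq, ← hCq]
      exact isIsogenous_smul _ _
    exact h1.trans' (hiso.quadraticTwist hd0)
  -- twist-minimality of `W` at `p`: `p² ∣ N(W₀)`; hence `N(W₀) = N(W)`
  have hpN₀ : p ^ 2 ∣ W₀.conductorNorm ℤ := by
    by_contra h
    exact hodd ⟨W₀, p, hE₀, hM₀, hp, hp2, hpN, htw, h⟩
  have hNN : W₀.conductorNorm ℤ = W.conductorNorm ℤ :=
    conductorNorm_eq_of_isIsogenous_twist_pStar_of_sq_dvd hnf h5 htw hpN hpN₀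
  have hadd : Addv W p := not_good_and_not_mult_of_sq_dvd_conductorNorm W hpN
  -- `0 ≤ ord_p j(W)`: a globally minimal model `W₁ = C₀ • (W ⊗ p*)` has `N(W₁) = N(W₀)` (modularity), so it is
  -- additive at `p` too, and a commuting `χ_{p*}`-pair additive on both sides is potentially good
  obtain ⟨C₀, hmin⟩ := hasGlobalMinimalModel_rat_holds (W.quadraticTwist ((((-1 : ℤ) ^ (p / 2) * p : ℤ)) : ℚ))
  haveI := hmin
  have hiso1 : IsIsogenous (C₀ • W.quadraticTwist ((((-1 : ℤ) ^ (p / 2) * p : ℤ)) : ℚ)) W₀ :=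
    (isIsogenous_of_smul (W.quadraticTwist ((((-1 : ℤ) ^ (p / 2) * p : ℤ)) : ℚ)) C₀).trans' hiso
  have hN1 : (C₀ • W.quadraticTwist ((((-1 : ℤ) ^ (p / 2) * p : ℤ)) : ℚ)).conductorNorm ℤ =
      W₀.conductorNorm ℤ :=
    conductorNorm_eq_of_isIsogenous_of_modularity
      (nonempty_modularParametrizationData_of_exists_isNewformOf hnf
        IsNewformOf.exists_maninConstant_ne_zero_holds) _ _ hiso1
  haveI : NeZero ((C₀ • W.quadraticTwist ((((-1 : ℤ) ^ (p / 2) * p : ℤ)) : ℚ)).conductorNorm ℤ) :=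
    ⟨by rw [hN1]; exact NeZero.ne _⟩
  have hadd₁ : Addv (C₀ • W.quadraticTwist ((((-1 : ℤ) ^ (p / 2) * p : ℤ)) : ℚ)) p :=
    not_good_and_not_mult_of_sq_dvd_conductorNorm _ (by rw [hN1]; exact hpN₀)
  have hj : 0 ≤ padicValRat p W.j := padicValRat_j_nonneg_of_pStar_pair_addv hp2 C₀ rfl hadd hadd₁
  -- potential ordinarity of `W` at `p`, discharged (§0)
  obtain ⟨hpo, -, -⟩ :=
    hasPotentiallyGoodOrdinaryReductionAtPrime_of_unstarred_of_semistabilityIndex_dvd W p h5 hadd hj hv4 he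
  have hv6 : padicValInt p W.minimalDiscriminantInt < 6 := by omega
  have hpos : 0 < D.modularDegree := D.deg_pos
  -- the optimal-orbit trichotomy: E-imc-9 leaves only case (i)
  have hcomm : (∃ u : VariableChange ℚ, u • W.quadraticTwist ((((-1 : ℤ) ^ (p / 2) * p : ℤ)) : ℚ) = W₀) ∧
      D₀.modularDegree = p * D.modularDegree := by
    rcases pStar_optimal_orbit_trichotomy_full hp hp2 W W₀ D D₀ hD hD₀ hpN hNN hiso with
      ⟨hu, hdeg, -⟩ | ⟨⟨u, hu⟩, hdeg, -⟩ | hdeg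
    · exact ⟨hu, hdeg⟩
    · -- case (ii): clause 2 of E-imc-9 with `C = u` gives `deg₀ = p·deg`, against `p·deg₀ = deg > 0`
      exfalso
      have h := (hO W W₀ D u hp h5 hpN hpo hv6 hD hu).2 D₀ hD₀
      have : p * (p * D.modularDegree) = D.modularDegree := by rw [← h]; exact hdeg
      nlinarith [hp.two_le]
    · -- case (iii), the flip `deg₀ = deg`: impossible under E-imc-9 (υ2's argument at a general `p`)
      exfalso
      -- E-imc-9: the twist model `W₁ = C₀ • (W ⊗ p*)` is optimal, with degree `p·deg`
      obtain ⟨⟨D₁, hD₁⟩, hall⟩ :=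
        hO W (C₀ • W.quadraticTwist ((((-1 : ℤ) ^ (p / 2) * p : ℤ)) : ℚ)) D C₀ hp h5 hpN hpo hv6 hD rfl
      have hdeg₁ : D₁.modularDegree = p * D.modularDegree := hall D₁ hD₁
      -- the two optimal data of the class share the newform's period lattice
      have hcoefEq : ∀ n : ℕ, cuspCoeff D₁.f n = cuspCoeff D₀.f n := fun n ↦ by
        rw [D₁.isNewformOf.2 n, D₀.isNewformOf.2 n, hiso1.LFunction_eq]
      have hΛ : periodLattice D₁.f = periodLattice D₀.f :=
        periodLattice_eq_of_level_eq_of_cuspCoeff_eq hN1 D₁.f D₀.f hcoefEq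
      have h1 : ∀ w ∈ periodLattice D₁.f, (1 : ℂ) * w ∈ periodLattice D₀.f := fun w hw ↦ by
        rw [one_mul, ← hΛ]; exact hw
      have h2 : ∀ w ∈ periodLattice D₀.f, (1 : ℂ) * w ∈ periodLattice D₁.f := fun w hw ↦ by
        rw [one_mul, hΛ]; exact hw
      have hcoef : ∀ n : ℕ, ‖cuspCoeff D₁.f n‖ = ‖cuspCoeff D₀.f n‖ := fun n ↦ by rw [hcoefEq]
      have ha : ‖(1 : ℂ)‖ ^ 2 = ((1 : ℕ) : ℝ) := by simp
      have hc' : (D₀.c : ℂ) ≠ 0 := by exact_mod_cast D₀.maninConstant_ne_zero_holds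
      have hc₁ : (D₁.c : ℂ) ≠ 0 := by exact_mod_cast D₁.maninConstant_ne_zero_holds
      have ht : (D₀.c : ℂ) * 1 / (D₁.c : ℂ) ≠ 0 := div_ne_zero (by rw [mul_one]; exact hc') hc₁
      have ht' : (D₁.c : ℂ) * 1 / (D₀.c : ℂ) ≠ 0 := div_ne_zero (by rw [mul_one]; exact hc₁) hc'
      obtain ⟨hmm, hmdeg⟩ := optimal_orbit_index_engine hN1 D₀ D₁ hD₀ hD₁ ha h1 h2 hcoef ht ht'
      rw [one_pow] at hmm
      have hm1 := Nat.eq_one_of_mul_eq_one_right hmm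
      rw [hm1, one_mul, one_mul] at hmdeg
      -- `deg(D₁) = deg(D₀) = deg(D)` against `deg(D₁) = p·deg(D)`, `deg(D) > 0`, `p ≥ 5`
      have : p * D.modularDegree = D.modularDegree := by omega
      nlinarith [hp.two_le]
  obtain ⟨⟨u, hu⟩, hup⟩ := hcomm
  -- near-invariance along the commuting pair: `v_p c₀ = v_p c`, `ord_p Δ_min(W₀) = ord_p Δ_min(W) + 6`
  rcases pStar_optimal_commuting_manin_near_invariance hp hp2 W W₀ u D D₀ hD hD₀ hpN hNN hu with
    ⟨-, ⟨hc, hΔ⟩ | ⟨-, hΔ⟩⟩ | ⟨hdeg₂, -⟩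
  · exact ⟨W₀, hE₀, hM₀, hne₀, u, D₀, hD₀, hu, hiso, htw, hNN, hpN₀, hup, hc, hΔ⟩
  · -- `ord_p Δ_min(W₀) + 6 = ord_p Δ_min(W) ≤ 4` is absurd
    omega
  · -- `p·deg₀ = deg` against `deg₀ = p·deg > 0`
    have : p * (p * D.modularDegree) = D.modularDegree := by rw [← hup]; exact hdeg₂
    nlinarith [hp.two_le]

/-! ## §2 `p > 7`: Edixhoven's case 1 from EdK and E-imc-9 (Kato-free) -/

/-- **Edixhoven's open CASE 1 at `p > 7` ⟸ EdK ∧ E-imc-9(p).** Granted Edixhoven's printed Kodaira statement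
(`hEdK`, cite-only: `p > 7`, lattice-optimal conductor-level datum, Kodaira type not II/III/IV ⟹ `p ∤ c`),
E-imc-9 `OrdinaryRamifiedTwistLaw p` (`hO`, OPEN) and modularity: a globally minimal `W` with lattice-optimal
conductor-level datum `D`, `p > 7`, `p² ∣ N(W)`, no odd semistable untwist, `ord_p Δ_min(W) ≤ 4` (types
II/III/IV) and `e ∣ p − 1` (potentially ORDINARY — Edixhoven's case 1, where his §4 proves only `v_p(c) ≤ 1`)
has `p ∤ c(D)`: the twin of §1 is of type IV*/III*/II* (`kodairaSymbolAt_upper_starred`), EdK gives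
`p ∤ c(D₀)`, and `v_p c(D) = v_p c(D₀) = 0`. No irreducibility hypothesis, no Kato reading.
Conditional result; closes nothing. [cite: EdixhovenManin1991, Thm. 3 and §4] [cite: ZagierCMB1985, §1] -/
theorem not_dvd_maninConstant_of_unstarred_ordinary_of_edixhovenKodairaFact_of_ordinaryRamifiedTwistLaw
    (hEdK : edixhoven_not_dvd_maninConstant_of_kodairaSymbol_ne) {p : ℕ} (hO : OrdinaryRamifiedTwistLaw p)
    (hnf : exists_isNewformOf) (hp : p.Prime) (h7 : 7 < p)
    (W : WeierstrassCurve ℚ) [W.IsElliptic] [W.IsGloballyMinimal] [NeZero (W.conductorNorm ℤ)]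
    (D : ModularParametrizationData W (W.conductorNorm ℤ)) (hD : IsLatticeOptimal D)
    (hpN : p ^ 2 ∣ W.conductorNorm ℤ)
    (hodd : ¬ (∃ (W' : WeierstrassCurve ℚ) (q : ℕ), W'.IsElliptic ∧ W'.IsGloballyMinimal ∧ q.Prime ∧
        q ≠ 2 ∧ q ^ 2 ∣ W.conductorNorm ℤ ∧
        IsIsogenous W (W'.quadraticTwist (((-1 : ℤ) ^ (q / 2) * q : ℤ) : ℚ)) ∧
        ¬ q ^ 2 ∣ W'.conductorNorm ℤ))
    (hv4 : padicValInt p W.minimalDiscriminantInt ≤ 4)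
    (he : 12 / Nat.gcd 12 (padicValInt p W.minimalDiscriminantInt) ∣ p - 1) :
    ¬ (p : ℤ) ∣ D.maninConstant := by
  haveI hpF : Fact p.Prime := ⟨hp⟩
  have h5 : 5 ≤ p := by omega
  obtain ⟨W₀, hE₀, hM₀, hne₀, u, D₀, hD₀, hu, -, -, hNN, hpN₀, -, hc, hΔ⟩ :=
    exists_commuting_starred_twin_of_ordinaryRamifiedTwistLaw hnf hp h5 hO W D hD hpN hodd hv4 he
  haveI := hE₀
  haveI := hM₀
  haveI := hne₀
  have hadd : Addv W p := not_good_and_not_mult_of_sq_dvd_conductorNorm W hpN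
  have hadd₀ : Addv W₀ p := not_good_and_not_mult_of_sq_dvd_conductorNorm W₀ hpN₀
  have hst := kodairaSymbolAt_upper_starred h5 u hu hadd hadd₀ hΔ
  have hII : W₀.kodairaSymbolAt (placeOf p) ≠ .II := by
    rcases hst with ⟨h, -⟩ | ⟨h, -⟩ | ⟨h, -⟩ <;> rw [h] <;> decide
  have hIII : W₀.kodairaSymbolAt (placeOf p) ≠ .III := by
    rcases hst with ⟨h, -⟩ | ⟨h, -⟩ | ⟨h, -⟩ <;> rw [h] <;> decide
  have hIV : W₀.kodairaSymbolAt (placeOf p) ≠ .IV := by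
    rcases hst with ⟨h, -⟩ | ⟨h, -⟩ | ⟨h, -⟩ <;> rw [h] <;> decide
  have hnd : ¬ (p : ℤ) ∣ D₀.maninConstant := hEdK W₀ D₀ hD₀ p hp h7 hII hIII hIV
  have hv₀ : padicValInt p D₀.c = 0 := padicValInt.eq_zero_of_not_dvd hnd
  have hc0 : D.c ≠ 0 := Int.cast_ne_zero.mp D.cast_c_ne_zero
  intro hpc
  have hpc' : (p : ℤ) ^ 1 ∣ D.c := by rw [pow_one]; exact hpc
  rcases (padicValInt_dvd_iff 1 D.c).mp hpc' with h | h
  · exact hc0 h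
  · omega

/-! ## §3 Bookkeeping: the RED(57♯) cuts pass to the twin -/

/-- **Transfer of the RED(57♯) cuts to the commuting starred twin.** For `u • (W ⊗ p*) = W₀`,
`W ∼ W₀ ⊗ p*`, `p² ∣ N(W)`, `p² ∣ N(W₀)`, `N(W₀) = N(W)`, `deg(D₀) = p·deg(D)` and
`ord_p Δ_min(W₀) = ord_p Δ_min(W) + 6` (the packet of §1): the odd and dyadic twist-minimality clauses,
`W[p]`-reducibility, `N > 5·10⁵`, `p ∣ deg` and «no `Iₙ*` fibre at `p`» all hold for `(W₀, D₀)` when the first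
four hold for `(W, D)` (§3 of `…ReducibleTwistTransport`, twist/isogeny invariance of reducibility,
`kodairaSymbolAt_upper_starred`). Pure bookkeeping. [cite: SilvermanATAEC1994, IV Table 4.1]
[cite: SilvermanAEC2009, X.5 Cor. 5.4] -/
theorem redCuts_of_commuting_starred_twin (hnf : exists_isNewformOf) {p : ℕ} [Fact p.Prime] (h5 : 5 ≤ p)
    {W W₀ : WeierstrassCurve ℚ} [W.IsElliptic] [W.IsGloballyMinimal] [W₀.IsElliptic] [W₀.IsGloballyMinimal]
    [NeZero (W.conductorNorm ℤ)] [NeZero (W₀.conductorNorm ℤ)] (u : VariableChange ℚ)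
    (hu : u • W.quadraticTwist ((((-1 : ℤ) ^ (p / 2) * p : ℤ)) : ℚ) = W₀)
    (htw : IsIsogenous W (W₀.quadraticTwist ((((-1 : ℤ) ^ (p / 2) * p : ℤ)) : ℚ)))
    (hpN : p ^ 2 ∣ W.conductorNorm ℤ) (hpN₀ : p ^ 2 ∣ W₀.conductorNorm ℤ)
    (hNN : W₀.conductorNorm ℤ = W.conductorNorm ℤ)
    (D : ModularParametrizationData W (W.conductorNorm ℤ)) (D₀ : ModularParametrizationData W₀ (W₀.conductorNorm ℤ))
    (hup : D₀.modularDegree = p * D.modularDegree)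
    (hΔ : padicValInt p W₀.minimalDiscriminantInt = padicValInt p W.minimalDiscriminantInt + 6)
    (hodd : ¬ (∃ (W' : WeierstrassCurve ℚ) (q : ℕ), W'.IsElliptic ∧ W'.IsGloballyMinimal ∧ q.Prime ∧
        q ≠ 2 ∧ q ^ 2 ∣ W.conductorNorm ℤ ∧
        IsIsogenous W (W'.quadraticTwist (((-1 : ℤ) ^ (q / 2) * q : ℤ) : ℚ)) ∧
        ¬ q ^ 2 ∣ W'.conductorNorm ℤ))
    (hdy : ¬ (∃ (W' : WeierstrassCurve ℚ) (d : ℤ), W'.IsElliptic ∧ W'.IsGloballyMinimal ∧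
        (d = -1 ∨ d = 2 ∨ d = -2) ∧ 2 ^ 2 ∣ W.conductorNorm ℤ ∧
        IsIsogenous W (W'.quadraticTwist (d : ℚ)) ∧ ¬ 2 ^ 2 ∣ W'.conductorNorm ℤ))
    (hred : ¬ W.HasIrreducibleModPGaloisRep p) (hN : 500000 < W.conductorNorm ℤ) :
    ¬ (∃ (W' : WeierstrassCurve ℚ) (q : ℕ), W'.IsElliptic ∧ W'.IsGloballyMinimal ∧ q.Prime ∧
        q ≠ 2 ∧ q ^ 2 ∣ W₀.conductorNorm ℤ ∧
        IsIsogenous W₀ (W'.quadraticTwist (((-1 : ℤ) ^ (q / 2) * q : ℤ) : ℚ)) ∧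
        ¬ q ^ 2 ∣ W'.conductorNorm ℤ) ∧
    ¬ (∃ (W' : WeierstrassCurve ℚ) (d : ℤ), W'.IsElliptic ∧ W'.IsGloballyMinimal ∧
        (d = -1 ∨ d = 2 ∨ d = -2) ∧ 2 ^ 2 ∣ W₀.conductorNorm ℤ ∧
        IsIsogenous W₀ (W'.quadraticTwist (d : ℚ)) ∧ ¬ 2 ^ 2 ∣ W'.conductorNorm ℤ) ∧
    ¬ W₀.HasIrreducibleModPGaloisRep p ∧ 500000 < W₀.conductorNorm ℤ ∧ p ∣ D₀.modularDegree ∧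
    ∀ n : ℕ, W₀.kodairaSymbolAt (placeOf p) ≠ .Istar n := by
  have hp : p.Prime := Fact.out
  have hp2 : p ≠ 2 := by omega
  have hd0 : ((((-1 : ℤ) ^ (p / 2) * p : ℤ)) : ℚ) ≠ 0 := by
    push_cast
    exact mul_ne_zero (pow_ne_zero _ (by norm_num)) (by exact_mod_cast hp.ne_zero)
  haveI : (W₀.quadraticTwist ((((-1 : ℤ) ^ (p / 2) * p : ℤ)) : ℚ)).IsElliptic := W₀.isElliptic_quadraticTwist hd0
  have hadd : Addv W p := not_good_and_not_mult_of_sq_dvd_conductorNorm W hpN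
  have hadd₀ : Addv W₀ p := not_good_and_not_mult_of_sq_dvd_conductorNorm W₀ hpN₀
  have hst := kodairaSymbolAt_upper_starred h5 u hu hadd hadd₀ hΔ
  refine ⟨oddTwistMinimal_of_isIsogenous_twist_pStar hnf hp2 htw hpN hNN hodd,
    dyadicTwistMinimal_of_isIsogenous_twist_pStar hp2 htw hNN hdy,
    fun h ↦ not_hasIrreducibleModPGaloisRep_of_isIsogenous htw hred
      ((hasIrreducibleModPGaloisRep_quadraticTwist_iff W₀ hd0 p).mpr h),
    by rw [hNN]; exact hN, ⟨D.modularDegree, hup⟩, fun n hn ↦ ?_⟩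
  rcases hst with ⟨h, -⟩ | ⟨h, -⟩ | ⟨h, -⟩ <;> rw [hn] at h <;> exact KodairaSymbol.noConfusion h

end Summit.BirchSwinnertonDyer.BirchSwinnertonDyer.Theorems

end
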